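import Summits.CriticalPhenomena.CardyFormulaZ2.Theses.ModulusResponse
import Summits.CriticalPhenomena.CardyFormulaZ2.Theorems.ModulusResponseSegmentRSWIffNonSlant
import HarnessLib

/-!
# Birth skeleton (BC3) for crux `SegmentRSW` — item stmt-CriticalPhenomena-6470,
# route `ModulusResponse` (rank 4), sub-problem `CardyFormulaZ2` — state after lead c2 (2026-08-17)

Crux BY NAME: `Summit.CriticalPhenomena.CardyFormulaZ2.Theses.ModulusResponse.SegmentRSW` —
UNIFORM RSW ON THE SELF-DUAL CELL SEGMENT: for the cell family `μ_u` (pinned inside the crux by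
its defining push-forward: at every vertex `m` of `ℤ²` the LEFT edge `{m - e₀, m}` is open iff the
fair coin `X_m`, the DOWN edge `{m - e₁, m}` iff `X_m ≠ D_m`, `D_m ~ Ber(u)`), one constant `c > 0`
with `μ_u(LR([0,2n]×[0,n])) ≥ c` and `μ_u(TB([0,n]×[0,2n])) ≥ c` for all `u ∈ [0,1/2]`, `n ≥ 1`.

## The cut and its status

The line (`Lines/birth.md`) reduces the crux to the sibling corner model
`M_t = Literature.Probability.Percolation.cornerPercolation t` (`μ_u = M_{2u} ∘ (x ↦ -x)⁻¹`) and
the sibling crux's kernel. ALL mechanical stubs are LANDED (lead c2, wave 1):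

* `stub_cellLaw` — `μ_u = (cornerPercolation ⟨2u⟩).map (relabel neg)` (p145387,
  `Theorems/ModulusResponseSegmentRSWStubCellLaw.lean`);
* `stub_negCrossing` — point reflection preserves rectangle-crossing probabilities under every
  `M_t` (p145294, `Theorems/ModulusResponseSegmentRSWStubNegCrossing.lean`);
* `stub_smallBoxes` — a `t`-free lower bound for `M_t(LR([0,2n]×[0,n]))` at each fixed `n`
  (p145304, `Theorems/ModulusResponseSegmentRSWStubSmallBoxes.lean`);

and the composition is landed as the sorry-free dividend
`Theorems/ModulusResponseSegmentRSWIffNonSlant.lean` (p146906): `segmentRSW_of_nonSlant`,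
`nonSlant_of_segmentRSW`, `segmentRSW_iff_nonSlant : SegmentRSW ↔ NonSlantStatement`,
`segmentRSW_iff_uniformBoxCrossing : SegmentRSW ↔ UniformBoxCrossing` (the sibling crux
stmt-CriticalPhenomena-5476), `segmentRSW_of_endpointDomination`, `segmentRSW_of_monotoneChirality`.

So the skeleton is now two lines: the ONE open stub is the kernel

* `stub_nonSlant : NonSlantStatement` — the `t`-uniform Non-Slant lemma for the corner models
  (Bollobás–Riordan 2010 Lemma 5.2 without the mirror, uniformly in `t`; VERBATIM the sibling
  crux's registered kernel, and by the dividend EQUIVALENT to this crux and to the sibling crux).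
  Research-level and open in print (Bollobás–Riordan 2010 Conj. 8.2 class): see
  `Cruxes/SegmentRSW/PROMOTE-stub_nonSlant.md` and the sibling dossiers
  `Cruxes/UniformBoxCrossing/KERNEL-DOSSIER-c2…c5.md`.

## Disproof used
No `Disproof.lean` exists for this crux (`ledger crux ls stmt-CriticalPhenomena-6470`); the
sibling kernel's `Cruxes/UniformBoxCrossing/Disproof.lean` and the landed negative bracket
`Theorems/UniformBoxCrossing/Negative/*` (FKG load-bearing, uniformity load-bearing, kernel false
beyond FKG, Klein-symmetric FKG staircase world without box crossing) concern `stub_nonSlant`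
verbatim and, through `segmentRSW_iff_uniformBoxCrossing`, this crux.

## Dead lines avoided
None registered on this crux. The cut does not posit a reduced-symmetry RSW theorem of
Köhler-Schindler–Tassion type (their Thm 1 needs the quarter turn ≡ an axis mirror given σ).
-/

noncomputable section

namespace Summit.CriticalPhenomena.CardyFormulaZ2.Cruxes.SegmentRSW.Birth

open MeasureTheory ProbabilityTheory
open Literature.Probability.Percolation Literature.Probability.LatticeModels
open Summit.CriticalPhenomena.CardyFormulaZ2.Theses.ModulusResponse
open Summit.CriticalPhenomena.CardyFormulaZ2.Cruxes.UniformBoxCrossing.NonSlantLine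

/-! ## The one open stub: the kernel -/

/-- **Stub (KERNEL; research; shared verbatim with the sibling crux stmt-CriticalPhenomena-5476).**
The `t`-uniform Non-Slant lemma for the corner models: there are `c > 0` and `n₀` such that for
every `t ∈ [0,1]` and `n ≥ n₀` the square `[0,n]²` contains, with `M_t`-probability at least `c`,
an open path from a bottom vertex `x` to a top vertex `y` with `|y₀ - x₀| ≤ 3n/5`
(`NonSlantStatement` of `Theorems/CardySelfDualSegmentUniformBoxCrossingDefs2.lean`;
Bollobás–Riordan 2010 Lemma 5.2 stated without the reflection its proof uses, uniformly in `t`).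
Why plausibly true: at `t = 1` (bond `ℤ²`) and `t = 0` (site `𝕋` in a sheared frame) it follows
from the known RSW theory, and numerically the Non-Slant probability is `.47–.53`, flat in `t`
(sibling NUMERICS); for `0 < t < 1` it is the research content of BOTH routes — in the tree
`SegmentRSW ↔ NonSlantStatement ↔ UniformBoxCrossing`. Why it might fail: only together with
box-crossing itself (Bollobás–Riordan 2010 Conj. 8.2, open).
[cite: BollobasRiordan2010, §5.1 Lemma 5.2] -/
theorem stub_nonSlant : NonSlantStatement := by
  sorry

/-! ## Composition: the stub concludes the crux BY NAME (landed, sorry-free) -/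

/-- **The skeleton theorem**: the kernel stub concludes the crux `SegmentRSW` BY NAME through the
landed composition `segmentRSW_of_nonSlant` (transfer `μ_u ↔ M_{2u}` + the sibling line's landed
Bollobás–Riordan engine + finite size). The only `sorry` of this file is `stub_nonSlant`.
[cite: BollobasRiordan2010, §5.1 Thm. 5.3] -/
theorem SegmentRSW_of : Summit.CriticalPhenomena.CardyFormulaZ2.Theses.ModulusResponse.SegmentRSW :=
  segmentRSW_of_nonSlant stub_nonSlant

end Summit.CriticalPhenomena.CardyFormulaZ2.Cruxes.SegmentRSW.Birth

end
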